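import Summits.Ventures.HSemireg.WedgeHankelRecurrenceHankelCauchyIndex

/-!
# Venture HSemireg — THE CAUCHY INDEX IS ADDITIVE OVER PARTIAL FRACTIONS: for coprime monic real `P₁`, `P₂` and any `Q₁`, `Q₂`,
# **`Ind((Q₁P₂ + Q₂P₁)/(P₁P₂)) = Ind(Q₁/P₁) + Ind(Q₂/P₂)`**, and for any numerator `Q`, **`Ind(Q/(P₁P₂)) = Ind(Q c₂/P₁) + Ind(Q c₁/P₂)`** whenever `c₁P₁ + c₂P₂ = 1` — the Chinese-remainder ORTHOGONAL SUM of
# Hermite's Hankel forms (N136: `H_t(b₁/m₁ + b₂/m₂) ≅ H_{e₁}(b₁/m₁) ⊥ H_{e₂}(b₂/m₂)`) read through `Sign H = Ind` (N152)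

HONEST FRAMING. Part of the Lean index of the computation cell `pub-hsemireg` (seat p10 gen 36, Sunday typer «UNIFORM-IN-n»).
REAL POLYNOMIALS, HANKEL FORMS AND THE TREE'S CAUCHY INDEX ONLY (PROVED Literature `Algebra/Polynomial/CauchyIndex` — `cauchyIndex` — imported through N152): no variety, no cohomology theory, no sheaf,
no Ext group and no semiregularity map is constructed here; nothing here says that HC / HC_CM / HC_AV holds; no Literature fact (unproved `Prop`) is declared or used.  Custodian versions as in
`WedgeHankelSiegelIdeal` (1/3).
SOURCE OF THE ARGUMENT (cited; held text read, `book:basu2006-algorithms-real-algebraic-geometry` pp. 66–67): BPR Definition 2.53 — the Cauchy index is a sum of LOCAL jumps over the real poles, so for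
coprime denominators the poles of `Q₁/P₁ + Q₂/P₂` are the disjoint union of those of the summands and the jumps add (the book uses this implicitly throughout §2.4 ∕ §9.1); here it is DERIVED from the
orthogonal-sum structure of the Hankel forms (N136, Chinese remainder) and BPR Thm. 9.4 (2) in the Hankel dress (N152).
DEDUP DISCLOSURE (`rg` of the whole tree + Mathlib, 2026-09-01): N136 has the sigPos ∕ sigNeg ∕ rank additivity of `H_t` over partial fractions; N152 `Sign H_t(Q/P) = Ind(Q/P)`; N154 ∕ N162 the other rules
of the Cauchy-index calculus; NO public statement gives the additivity of `cauchyIndex` over coprime denominators — that is this file.  3 names: 0 hits tree-wide.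

WHAT IS IN THE TREE (or staged ahead).  N136 (`…SignatureCoprime`): **`sigPos_hankelSq_dualSeq_mul_of_isCoprime`**, `sigNeg_hankelSq_dualSeq_mul_of_isCoprime`, `sigPos_hankelSq_dualSeq_mul_of_eq_one`,
`sigNeg_hankelSq_dualSeq_mul_of_eq_one`; N152 **`sigPos_sub_sigNeg_hankelSq_dualSeq_eq_cauchyIndex_of_monic`**; Mathlib `Polynomial.Monic.mul`, `natDegree_mul`, `roots_mul`.
THIS FILE (namespace `Summit.Ventures.HSemireg.Wedge.HankelOuter` continued; CHAINED on N152 (+ tree N136); 0 definitions):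
* §796 **`cauchyIndex_mul_add_eq_add`** (`P₁`, `P₂` monic coprime real of degrees `e₁ + 1`, `e₂ + 1`, any `Q₁`, `Q₂`, window containing the real roots of `P₁P₂`:
  `Ind((Q₁P₂ + Q₂P₁)/(P₁P₂)) = Ind(Q₁/P₁) + Ind(Q₂/P₂)`), **`cauchyIndex_mul_eq_add_of_eq_one`** (`c₁P₁ + c₂P₂ = 1`, any `Q`: `Ind(Q/(P₁P₂)) = Ind(Qc₂/P₁) + Ind(Qc₁/P₂)`),
  `roots_mem_window_of_mul` (bookkeeping: a window for `P₁P₂` is a window for each factor).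
CAVEATS.  `ℝ` only; `P₁`, `P₂` MONIC (the Hankel route); the window must contain all real roots of the product.
Nothing Ext-side.  New names only.
-/

open Module Polynomial
open scoped Matrix Polynomial

namespace Summit.Ventures.HSemireg.Wedge.HankelOuter

open Summit.Ventures.HSemireg.Wedge Summit.Ventures.HSemireg.Wedge.Hankel
open Literature.Algebra.Polynomial (cauchyIndex)

/-! ## §796. Additivity of the Cauchy index over coprime denominators -/

/-- A window containing the real roots of `P₁P₂` (both factors non-zero) contains those of `P₁` and of `P₂`. [bookkeeping; Mathlib `roots_mul`] -/
theorem roots_mem_window_of_mul {P₁ P₂ : ℝ[X]} (h₁ : P₁ ≠ 0) (h₂ : P₂ ≠ 0) {lo hi : ℝ} (h : ∀ x ∈ (P₁ * P₂).roots, lo < x ∧ x < hi) :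
    (∀ x ∈ P₁.roots, lo < x ∧ x < hi) ∧ (∀ x ∈ P₂.roots, lo < x ∧ x < hi) := by
  rw [roots_mul (mul_ne_zero h₁ h₂)] at h
  exact ⟨fun x hx => h x (Multiset.mem_add.2 (Or.inl hx)), fun x hx => h x (Multiset.mem_add.2 (Or.inr hx))⟩

/-- **THE CAUCHY INDEX IS ADDITIVE OVER PARTIAL FRACTIONS: `Ind((Q₁P₂ + Q₂P₁)/(P₁P₂)) = Ind(Q₁/P₁) + Ind(Q₂/P₂)`** for `P₁`, `P₂` monic coprime real of degrees `e₁ + 1`, `e₂ + 1`, any `Q₁`, `Q₂`, and a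
window `(lo, hi)` containing the real roots of `P₁P₂` (N136's Chinese-remainder orthogonal sum of the Hankel forms + N152's `Sign H = Ind` three times). [this file, §796] -/
theorem cauchyIndex_mul_add_eq_add {e₁ e₂ : ℕ} {P₁ P₂ : ℝ[X]} (hP₁ : P₁.Monic) (hP₂ : P₂.Monic) (hc : IsCoprime P₁ P₂) (hd₁ : P₁.natDegree = e₁ + 1) (hd₂ : P₂.natDegree = e₂ + 1)
    (Q₁ Q₂ : ℝ[X]) {lo hi : ℝ} (hroots : ∀ x ∈ (P₁ * P₂).roots, lo < x ∧ x < hi) :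
    cauchyIndex (P₁ * P₂) (Q₁ * P₂ + Q₂ * P₁) lo hi = cauchyIndex P₁ Q₁ lo hi + cauchyIndex P₂ Q₂ lo hi := by
  obtain ⟨hr₁, hr₂⟩ := roots_mem_window_of_mul hP₁.ne_zero hP₂.ne_zero hroots
  have hd : (P₁ * P₂).natDegree = (e₁ + e₂ + 1) + 1 := by rw [hP₁.natDegree_mul hP₂, hd₁, hd₂]; ring
  rw [← sigPos_sub_sigNeg_hankelSq_dualSeq_eq_cauchyIndex_of_monic (hP₁.mul hP₂) hd le_rfl _ hroots, ← sigPos_sub_sigNeg_hankelSq_dualSeq_eq_cauchyIndex_of_monic hP₁ hd₁ le_rfl Q₁ hr₁,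
    ← sigPos_sub_sigNeg_hankelSq_dualSeq_eq_cauchyIndex_of_monic hP₂ hd₂ le_rfl Q₂ hr₂, sigPos_hankelSq_dualSeq_mul_of_isCoprime hP₁ hP₂ hc hd₁ hd₂ (by omega) Q₁ Q₂,
    sigNeg_hankelSq_dualSeq_mul_of_isCoprime hP₁ hP₂ hc hd₁ hd₂ (by omega) Q₁ Q₂]
  push_cast
  ring

/-- **`Ind(Q/(P₁P₂)) = Ind(Q·c₂/P₁) + Ind(Q·c₁/P₂)` whenever `c₁P₁ + c₂P₂ = 1`** (`P₁`, `P₂` monic real of degrees `e₁ + 1`, `e₂ + 1`, any `Q`, window containing the real roots of `P₁P₂`): every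
fraction with denominator `P₁P₂` splits into partial fractions, and the index splits accordingly. [this file, §796] -/
theorem cauchyIndex_mul_eq_add_of_eq_one {e₁ e₂ : ℕ} {P₁ P₂ c₁ c₂ : ℝ[X]} (hP₁ : P₁.Monic) (hP₂ : P₂.Monic) (hcc : c₁ * P₁ + c₂ * P₂ = 1) (hd₁ : P₁.natDegree = e₁ + 1) (hd₂ : P₂.natDegree = e₂ + 1)
    (Q : ℝ[X]) {lo hi : ℝ} (hroots : ∀ x ∈ (P₁ * P₂).roots, lo < x ∧ x < hi) :
    cauchyIndex (P₁ * P₂) Q lo hi = cauchyIndex P₁ (Q * c₂) lo hi + cauchyIndex P₂ (Q * c₁) lo hi := by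
  obtain ⟨hr₁, hr₂⟩ := roots_mem_window_of_mul hP₁.ne_zero hP₂.ne_zero hroots
  have hd : (P₁ * P₂).natDegree = (e₁ + e₂ + 1) + 1 := by rw [hP₁.natDegree_mul hP₂, hd₁, hd₂]; ring
  rw [← sigPos_sub_sigNeg_hankelSq_dualSeq_eq_cauchyIndex_of_monic (hP₁.mul hP₂) hd le_rfl _ hroots, ← sigPos_sub_sigNeg_hankelSq_dualSeq_eq_cauchyIndex_of_monic hP₁ hd₁ le_rfl _ hr₁,
    ← sigPos_sub_sigNeg_hankelSq_dualSeq_eq_cauchyIndex_of_monic hP₂ hd₂ le_rfl _ hr₂, sigPos_hankelSq_dualSeq_mul_of_eq_one hP₁ hP₂ hcc hd₁ hd₂ (by omega) Q,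
    sigNeg_hankelSq_dualSeq_mul_of_eq_one hP₁ hP₂ hcc hd₁ hd₂ (by omega) Q]
  push_cast
  ring

end Summit.Ventures.HSemireg.Wedge.HankelOuter
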